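import Literature.NumberTheory.Automorphic.OrdinaryPartOfFiniteModule
import Mathlib.Data.Finset.NoncommProd
import HarnessLib

/-!
# The ordinary part of a product of commuting operators: `M^{UV-ord} = M^{U-ord} ∩ M^{V-ord}`

Topic `NumberTheory/Automorphic`; namespace `Literature.NumberTheory.Automorphic`; theorems only,
continuing `OrdinaryPartOfFiniteModule` (Fitting: an endomorphism `U` of a finite module acts
bijectively on `⋂ₙ range Uⁿ`).

For COMMUTING endomorphisms `U, V` of a finite module `M`,
**`⋂ₙ range (UV)ⁿ = (⋂ₙ range Uⁿ) ∩ (⋂ₙ range Vⁿ)`** (`iInf_range_pow_mul_eq`): `⊆` because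
`(UV)ⁿ = Uⁿ Vⁿ = Vⁿ Uⁿ`; `⊇` because `U` and `V` both preserve the intersection `Z` and are injective
on it (Fitting), hence bijective (`Z` is finite), so every element of `Z` is in the image of
`(UV)ⁿ`.  By induction the same holds for any finite family of pairwise commuting operators
(`iInf_range_pow_noncommProd_eq`).  In Hida theory this identifies the ordinary part for
`U_p = ∏_{v ∣ p} U_v` (Hida's idempotent `e = lim U_p^{n!}`) with the intersection of the
`U_v`-ordinary parts, the form of the tree's `TameLevel.ordinaryPart`
([KhareThorne2017, §2.4, Lemma 2.10; §6.4]; [Hida1994AIF, §2]).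

## References

* C. Khare, J. A. Thorne, Amer. J. Math. 139 (2017), §2.4 Lemma 2.10, §6.4 (arXiv:1409.7007, held).
  [KhareThorne2017]
* H. Hida, Ann. Inst. Fourier 44 (1994), §2 (held). [Hida1994AIF]
-/

namespace Literature.NumberTheory.Automorphic

variable {R M : Type*} [Ring R] [AddCommGroup M] [Module R M]

/-- `V` preserves `⋂ₙ range Uⁿ` when it commutes with `U`. [folklore] -/
theorem mapsTo_iInf_range_pow_of_commute {U V : Module.End R M} (h : Commute U V) :
    Set.MapsTo V (⨅ n : ℕ, LinearMap.range (U ^ n) : Submodule R M)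
      (⨅ n : ℕ, LinearMap.range (U ^ n) : Submodule R M) := by
  intro x hx
  simp only [SetLike.mem_coe, Submodule.mem_iInf, LinearMap.mem_range] at hx ⊢
  intro n
  obtain ⟨y, rfl⟩ := hx n
  exact ⟨V y, by rw [← Module.End.mul_apply, ← Module.End.mul_apply, (h.pow_left n).eq]⟩

/-- `range (UV)ⁿ ⊆ range Uⁿ` for commuting `U, V`. [folklore] -/
theorem iInf_range_pow_mul_le_left {U V : Module.End R M} (h : Commute U V) :
    (⨅ n : ℕ, LinearMap.range ((U * V) ^ n)) ≤ ⨅ n : ℕ, LinearMap.range (U ^ n) := by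
  refine iInf_mono fun n => ?_
  rw [h.mul_pow]
  exact LinearMap.range_comp_le_range _ _

/-- `range (UV)ⁿ ⊆ range Vⁿ` for commuting `U, V`. [folklore] -/
theorem iInf_range_pow_mul_le_right {U V : Module.End R M} (h : Commute U V) :
    (⨅ n : ℕ, LinearMap.range ((U * V) ^ n)) ≤ ⨅ n : ℕ, LinearMap.range (V ^ n) := by
  rw [h.eq]
  exact iInf_range_pow_mul_le_left h.symm

/-- A power of an endomorphism mapping a set onto itself maps it onto itself. [folklore] -/
theorem surjOn_pow_of_surjOn {T : Module.End R M} {Z : Set M} (hT : Set.SurjOn T Z Z) (n : ℕ) :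
    Set.SurjOn (T ^ n) Z Z := by
  induction n with
  | zero =>
    intro x hx
    exact ⟨x, hx, rfl⟩
  | succ n ih =>
    rw [pow_succ']
    exact hT.comp ih

/-- **`⋂ₙ range (UV)ⁿ = (⋂ₙ range Uⁿ) ∩ (⋂ₙ range Vⁿ)` for commuting endomorphisms of a finite
module.** [cite: KhareThorne2017, §2.4, Lemma 2.10] -/
theorem iInf_range_pow_mul_eq [Finite M] {U V : Module.End R M} (h : Commute U V) :
    (⨅ n : ℕ, LinearMap.range ((U * V) ^ n)) =
      (⨅ n : ℕ, LinearMap.range (U ^ n)) ⊓ ⨅ n : ℕ, LinearMap.range (V ^ n) := by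
  refine le_antisymm (le_inf (iInf_range_pow_mul_le_left h) (iInf_range_pow_mul_le_right h)) ?_
  intro x hx
  set Z : Submodule R M := (⨅ n : ℕ, LinearMap.range (U ^ n)) ⊓ ⨅ n : ℕ, LinearMap.range (V ^ n)
    with hZ
  -- `U` and `V` preserve `Z` and are injective on it, hence bijective (`Z` is finite)
  have hmU : Set.MapsTo U (Z : Set M) Z := fun y hy =>
    ⟨mapsTo_iInf_range_pow_self U hy.1, mapsTo_iInf_range_pow_of_commute h.symm hy.2⟩
  have hmV : Set.MapsTo V (Z : Set M) Z := fun y hy =>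
    ⟨mapsTo_iInf_range_pow_of_commute h hy.1, mapsTo_iInf_range_pow_self V hy.2⟩
  have hiU : Set.InjOn U (Z : Set M) := (injOn_iInf_range_pow U).mono fun y hy => hy.1
  have hiV : Set.InjOn V (Z : Set M) := (injOn_iInf_range_pow V).mono fun y hy => hy.2
  haveI : Finite (Z : Set M) := Subtype.finite
  have hsU : Set.SurjOn U (Z : Set M) Z :=
    (Set.MapsTo.restrict_surjective_iff hmU).1
      (Finite.injective_iff_surjective.1 ((Set.MapsTo.restrict_inj hmU).2 hiU))
  have hsV : Set.SurjOn V (Z : Set M) Z :=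
    (Set.MapsTo.restrict_surjective_iff hmV).1
      (Finite.injective_iff_surjective.1 ((Set.MapsTo.restrict_inj hmV).2 hiV))
  have hsUV : Set.SurjOn (U * V) (Z : Set M) Z := hsU.comp hsV
  simp only [Submodule.mem_iInf, LinearMap.mem_range]
  intro n
  obtain ⟨y, -, hy⟩ := surjOn_pow_of_surjOn hsUV n hx
  exact ⟨y, hy⟩

/-- **The ordinary part of a finite product of pairwise commuting endomorphisms of a finite module is
the intersection of the ordinary parts** (`e_{U_p} = ∏_v e_{U_v}` for `U_p = ∏_v U_v`).
[cite: KhareThorne2017, §2.4, Lemma 2.10; §6.4] [cite: Hida1994AIF, §2] -/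
theorem iInf_range_pow_noncommProd_eq [Finite M] {ι : Type*} (s : Finset ι) (T : ι → Module.End R M)
    (hcomm : (s : Set ι).Pairwise fun i j => Commute (T i) (T j)) :
    (⨅ n : ℕ, LinearMap.range (s.noncommProd T hcomm ^ n)) =
      ⨅ i ∈ s, ⨅ n : ℕ, LinearMap.range (T i ^ n) := by
  classical
  induction s using Finset.induction_on with
  | empty =>
    rw [Finset.noncommProd_empty]
    refine le_antisymm (le_iInf fun i => le_iInf fun hi => absurd hi (Finset.notMem_empty i)) ?_
    refine le_iInf fun n => ?_
    rw [one_pow]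
    exact le_of_le_of_eq le_top (LinearMap.range_eq_top.2 fun y => ⟨y, rfl⟩).symm
  | insert i s hi ih =>
    have hcomm' : (s : Set ι).Pairwise fun i j => Commute (T i) (T j) :=
      hcomm.mono (by simp)
    have hc : Commute (T i) (s.noncommProd T hcomm') :=
      Finset.noncommProd_commute s T hcomm' (T i) fun j hj =>
        hcomm (Finset.mem_insert_self i s) (Finset.mem_insert_of_mem hj)
          (fun h => hi (h ▸ hj))
    rw [Finset.noncommProd_insert_of_notMem _ _ _ _ hi, iInf_range_pow_mul_eq hc, ih hcomm',
      Finset.iInf_insert]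

end Literature.NumberTheory.Automorphic
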